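import Literature.NumberTheory.Automorphic.Liu2021.AppendixC.EtaleH1Pullback
import HarnessLib

/-!
# The level map `Φ_K : ℂ ⊗_{M_μ} (ℚ ⊗ Hom_E(A_K, A_μ)) → Hom(ℚ_ℓ^{ac}·α, ℚ_ℓ^{ac} ⊗ H¹_ét(A_K))` of the Faltings step: injective, with range
# the `Γ_E`-compatible maps ([Liu 2021, Thm 4.18 proof l. 2254–2263] at ONE level, at the one object `D_μ`)

Topic `NumberTheory/Automorphic/Liu2021/AppendixC`; namespace `Literature.NumberTheory.Automorphic.Liu2021.AppendixC`.  Definitions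
with bodies + theorems; no named fact, no `sorry`; net Literature debt 0.  Continuation of `EtaleH1Pullback.lean` (p601037: `h1PullBar`,
`h1PullBarQ`, `h1PullBarK`, Faltings/Mumford read on `H¹`) and `CMEigenlineRankOne.lean` (p598849: the line `ℚ_ℓ^{ac}·α`, its
`Γ_E`-character, the `M_μ`-projector), at the ONE-OBJECT carriers of `RestOne.lean` (`ObjOne`, `AμOne`, `iOne`, scalars
`fieldOfValues E μ` acting through `RestOne.endScalarOne`).  Cell `hodgecm-mathlib` (D-0151), line `a3-liu418` v3, stub F
`stub_faltingsIsotypic` (KEY `a3-faltings-isotypic`, seat A-p17).  HC_CM is proved only modulo the 7 printed citations until rung 0 closes;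
the range statement is CONDITIONAL on the named fact `Motives.faltings_tate_bijective X A_μ ℓ` (VI-1), taken as a hypothesis.

## The printed text (Y. Liu, arXiv:2102.11518, `FJcycle.tex` l. 2254–2263)

«(4.2) induces the following map `Ω(μ) ⊗_{M_μ,ι_ℓ} ℚ_ℓ^{ac} → Hom_{ℚ_ℓ^{ac}[𝔾(𝔸_F^∞)]}(…, H¹_ét(A_∞ ⊗_{E,τ'} ℂ, ℚ_ℓ^{ac}))` […] By Faltings'
isogeny theorem [Fal83], we have a canonical isomorphism `Ω(μ) ⊗_{M_μ,ι_ℓ} ℚ_ℓ^{ac} ≃ Hom_{ℚ_ℓ^{ac}[Gal(ℂ/τ'(E))]}(ℚ_ℓ^{ac}·α,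
H¹_ét(A_μ ⊗_{E,τ'} ℂ, ℚ_ℓ^{ac}))`.  However, by Definition 4.5 (2), the action of `Gal(ℂ/τ'(E))` on the line `ℚ_ℓ^{ac}·α` spanned by `α` is
given by [a] character».  Here: ONE level (`Ω(μ)_K = Hom_E(A_K, A_μ)_ℚ`, Rem. 4.17), `X` in the rôle of `A_K`.

## Contents (all PROVED; axioms `propext`, `Classical.choice`, `Quot.sound`)

* `toFieldOfValues` (+ two `simp` lemmas) — the element of `fieldOfValues E μ` under an element of `muAlgValueField E μ` (same complex number);
  `smul_eq_postAlg` — «`M_μ` acts via `i_μ`» unfolded at the one object.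
* `faltingsLevel` = **`Φ`**: `z ⊗ t ↦ ι(z) · (t^*)|_{ℚ_ℓ^{ac}·α}` on `ℂ ⊗_{M_μ} (ℚ ⊗ Hom_E(X, A_μ))`, additive, `ι`-semilinear (`faltingsLevel_smul`),
  `faltingsLevel_tmul_apply`, `faltingsLevel_tmul_pre_apply` (compatibility with pull-back of sources);
  **`galoisH1Bar_faltingsLevel_apply`** — range ⊆ the `Γ_E`-compatible maps.
* `toComplexTensor` (`π : c ⊗ t ↦ ι⁻¹(c) ⊗ t`, surjective, `ι⁻¹`-semilinear) and its compatibilities with `h1PullBarK` and with the `M_μ`-action;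
  **`faltingsLevel_injective`** — `Φ` is INJECTIVE, UNCONDITIONALLY (Mumford §19 Thm 3 ⊗ `ℚ_ℓ^{ac}` = `h1PullBarK_injective`, cut by the
  `M_μ`-projector of `exists_cmEigenline_projector`).
* **`exists_faltingsLevel_eq`** — granted `faltings_tate_bijective X A_μ ℓ`, every `Γ_E`-compatible `h : ℚ_ℓ^{ac}·α → ℚ_ℓ^{ac} ⊗ H¹_ét(X)` is a
  `Φ(w)` (extend by the projector, `mem_span_h1PullBar_of_galois`, restrict).

References: [Liu2021] Thm 4.18 proof l. 2254–2263, Def. 4.3 l. 1908–1912, Def. 4.16 l. 2219; [Faltings1983Endlichkeit] §5 Satz 4, Korollar 1;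
[MumfordAV1970] §19 Thm. 3.
-/

noncomputable section

open CategoryTheory NumberField
open scoped TensorProduct

namespace Literature.NumberTheory.Automorphic.Liu2021.AppendixC

open Literature.AlgebraicGeometry.Motives (AbelianVariety faltings_tate_bijective faltings_rationalTate_bijective_of)
open Literature.AlgebraicGeometry.Motives.AbelianVariety (rationalTateModuleMap rationalTateModuleMap_comp rationalTateModuleMap_add
  rationalTateModuleMap_zero rationalTateModuleMap_id rationalTateRep_rationalTateModuleMap rationalTateAction rationalTateAction_of
  rationalTateAction_algebraMap module_finite_tateModule_of_cast_ne_zero endAlgebra faltingsRationalTateMap rationalTateHom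
  toLinearMap_rationalTateIntertwiningMap faltingsRationalTateMap_tmul)
open Literature.RepresentationTheory.IntertwiningBaseChange Literature.RepresentationTheory.IntertwiningDual

/-! ## §3 At the one object `D_μ`: the level map `Φ_K : ℂ ⊗_{M_μ} (ℚ ⊗ Hom_E(X, A_μ)) → Hom(ℚ_ℓ^{ac}·α, ℚ_ℓ^{ac} ⊗ H¹_ét(X))` -/

section FieldOfValues

variable {E : Type} [Field E] [NumberField E] {μ : IdeleClassGroup E →ₜ* Circle}

open RestOne (ofFieldOfValues)

/-- The element of the as-printed `M_μ` (`fieldOfValues E μ`) underlying an element of the tree's `M_μ` (`muAlgValueField E μ`) —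
the inverse of `RestOne.ofFieldOfValues` on elements (`fieldOfValues_toSubfield`). [cite: Liu2021, Def. 4.3 (FJcycle.tex l. 1908–1912)] -/
def toFieldOfValues (m : IdeleClassGroup.muAlgValueField E μ) : fieldOfValues E μ :=
  ⟨(m : ℂ), (mem_fieldOfValues_iff E μ (m : ℂ)).2 m.2⟩

/-- `ofFieldOfValues (toFieldOfValues m) = m`. [cite: Liu2021, Def. 4.3 (FJcycle.tex l. 1908–1912)] -/
@[simp] theorem ofFieldOfValues_toFieldOfValues (m : IdeleClassGroup.muAlgValueField E μ) :
    ofFieldOfValues E μ (toFieldOfValues m) = m :=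
  Subtype.ext rfl

/-- `(toFieldOfValues m : ℂ) = m`. [cite: Liu2021, Def. 4.3 (FJcycle.tex l. 1908–1912)] -/
@[simp] theorem coe_toFieldOfValues (m : IdeleClassGroup.muAlgValueField E μ) : ((toFieldOfValues m : fieldOfValues E μ) : ℂ) = m :=
  rfl

end FieldOfValues

section Level

variable {E : Type} [Field E] [NumberField E] [IsCMField E]
variable {L : Type} [Field L] [NumberField L] [IsGalois ℚ L] (φ : E →ₐ[ℚ] L) (ιE : L →+* ℂ)
variable {μ : IdeleClassGroup E →ₜ* Circle} (hμ : IdeleClassGroup.IsConjugateSymplectic E μ)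
  (hw : IdeleClassGroup.HasWeight E μ 1) (Car : Def45.Carriers E μ)
variable (obj : RestOne.ObjOne φ ιE hμ hw Car) (ℓ : ℕ) [Fact ℓ.Prime] (ι : ℂ ≃+* AlgebraicClosure ℚ_[ℓ]) (X : AbelianVariety E)

open RestOne (QHom AμOne iOne ObjOne ofFieldOfValues)
open scoped Literature.NumberTheory.Automorphic.Liu2021.AppendixC.RestOne

/-- «`M_μ` acts via `i_μ`» on `ℚ ⊗ Hom_E(X, A_μ)` is post-composition through `i_μ`: `s • t = (i_μ s)_* t` (unfolding of the
scoped instance `RestOne.endScalarOne`). [cite: Liu2021, Def. 4.16 (FJcycle.tex l. 2219)] -/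
theorem smul_eq_postAlg (s : fieldOfValues E μ) (t : QHom X (AμOne φ ιE hμ hw Car obj)) :
    s • t = RestOne.postAlg X _ (iOne φ ιE hμ hw Car obj (ofFieldOfValues E μ s)) t :=
  rfl

/-- **The level map `Φ` of the Faltings step at the object `D_μ`** ([Liu2021] l. 2258: «`Ω(μ) ⊗_{M_μ,ι_ℓ} ℚ_ℓ^{ac} ≃ Hom(ℚ_ℓ^{ac}·α, H¹_ét(…))`»
at ONE level `X = A_K`, before the colimit): `z ⊗ t ↦ ι(z) · (t^*)|_{ℚ_ℓ^{ac}·α}` on `ℂ ⊗_{M_μ} (ℚ ⊗_ℤ Hom_E(X, A_μ))`, additive (and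
`ι`-semilinear, `faltingsLevel_smul`).  Well defined because `M_μ` acts on the line through `ι|_{M_μ}` (the eigenline condition).
[cite: Liu2021, Thm 4.18 proof (FJcycle.tex l. 2254–2262)] -/
def faltingsLevel : ℂ ⊗[fieldOfValues E μ] QHom X (AμOne φ ιE hμ hw Car obj) →+
    (cmEigenline ℓ (AμOne φ ιE hμ hw Car obj) (IdeleClassGroup.muAlgValueField E μ) (iOne φ ιE hμ hw Car obj) ι →ₗ[AlgebraicClosure ℚ_[ℓ]]
      AlgebraicClosure ℚ_[ℓ] ⊗[ℚ_[ℓ]] Module.Dual ℚ_[ℓ] (X.rationalTateModule ℓ)) :=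
  TensorProduct.liftAddHom
    { toFun := fun z => ((ι z) • LinearMap.lcomp (AlgebraicClosure ℚ_[ℓ])
          (AlgebraicClosure ℚ_[ℓ] ⊗[ℚ_[ℓ]] Module.Dual ℚ_[ℓ] (X.rationalTateModule ℓ)) (Submodule.subtype _)).toAddMonoidHom.comp
        (h1PullBarQ ℓ X (AμOne φ ιE hμ hw Car obj)).toAddMonoidHom
      map_zero' := by
        refine AddMonoidHom.ext fun t => ?_
        rw [map_zero, zero_smul]
        rfl
      map_add' := fun z z' => by
        refine AddMonoidHom.ext fun t => ?_
        simp only [AddMonoidHom.coe_comp, Function.comp_apply, LinearMap.toAddMonoidHom_coe, AddMonoidHom.add_apply, map_add,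
          add_smul, LinearMap.add_apply] }
    (fun s z t => by
      refine LinearMap.ext fun y => ?_
      simp only [AddMonoidHom.coe_comp, AddMonoidHom.coe_mk, ZeroHom.coe_mk, Function.comp_apply, LinearMap.toAddMonoidHom_coe,
        LinearMap.smul_apply, LinearMap.lcomp_apply, Submodule.coe_subtype]
      rw [smul_eq_postAlg, h1PullBarQ_postAlg, LinearMap.comp_apply,
        (mem_cmEigenline_iff ℓ _ _ _ ι y.1).1 y.2 (ofFieldOfValues E μ s), (h1PullBarQ ℓ X _ t).map_smul, smul_smul]
      congr 1
      rw [RestOne.coe_ofFieldOfValues, Algebra.smul_def, map_mul, mul_comm]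
      rfl)

/-- `Φ` on pure tensors: `Φ(z ⊗ t)(y) = ι(z) · t^*(y)`. [cite: Liu2021, Thm 4.18 proof (FJcycle.tex l. 2254–2262)] -/
theorem faltingsLevel_tmul_apply (z : ℂ) (t : QHom X (AμOne φ ιE hμ hw Car obj))
    (y : cmEigenline ℓ (AμOne φ ιE hμ hw Car obj) (IdeleClassGroup.muAlgValueField E μ) (iOne φ ιE hμ hw Car obj) ι) :
    faltingsLevel φ ιE hμ hw Car obj ℓ ι X (z ⊗ₜ t) y = ι z • h1PullBarQ ℓ X (AμOne φ ιE hμ hw Car obj) t y := by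
  rw [faltingsLevel, TensorProduct.liftAddHom_tmul]
  rfl

/-- `Φ` is `ι`-semilinear: `Φ(z · w) = ι(z) · Φ(w)`. [cite: Liu2021, Thm 4.18 proof (FJcycle.tex l. 2254–2262)] -/
theorem faltingsLevel_smul (z : ℂ) (w : ℂ ⊗[fieldOfValues E μ] QHom X (AμOne φ ιE hμ hw Car obj)) :
    faltingsLevel φ ιE hμ hw Car obj ℓ ι X (z • w) = ι z • faltingsLevel φ ιE hμ hw Car obj ℓ ι X w := by
  induction w using TensorProduct.induction_on with
  | zero => rw [smul_zero, map_zero, smul_zero]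
  | tmul z' t =>
    rw [TensorProduct.smul_tmul', smul_eq_mul]
    refine LinearMap.ext fun y => ?_
    rw [faltingsLevel_tmul_apply, LinearMap.smul_apply, faltingsLevel_tmul_apply, map_mul, mul_smul]
  | add x y hx hy => rw [smul_add, map_add, map_add, hx, hy, smul_add]

/-- **Range ⊆ (easy half): `Φ(w)` is `Γ_E`-compatible** — if `σ` acts by `c` on the line `ℚ_ℓ^{ac}·α` then `σ` acts by `c` on
every value `Φ(w)(y)` (pull-backs commute with `Γ_E`). [cite: Liu2021, Thm 4.18 proof (FJcycle.tex l. 2258–2263)] -/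
theorem galoisH1Bar_faltingsLevel_apply (w : ℂ ⊗[fieldOfValues E μ] QHom X (AμOne φ ιE hμ hw Car obj))
    (σ : Field.absoluteGaloisGroup E) (c : AlgebraicClosure ℚ_[ℓ])
    (hc : ∀ x ∈ cmEigenline ℓ (AμOne φ ιE hμ hw Car obj) (IdeleClassGroup.muAlgValueField E μ) (iOne φ ιE hμ hw Car obj) ι,
      galoisH1Bar ℓ (AμOne φ ιE hμ hw Car obj) σ x = c • x)
    (y : cmEigenline ℓ (AμOne φ ιE hμ hw Car obj) (IdeleClassGroup.muAlgValueField E μ) (iOne φ ιE hμ hw Car obj) ι) :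
    galoisH1Bar ℓ X σ (faltingsLevel φ ιE hμ hw Car obj ℓ ι X w y) = c • faltingsLevel φ ιE hμ hw Car obj ℓ ι X w y := by
  induction w using TensorProduct.induction_on with
  | zero => rw [map_zero, LinearMap.zero_apply, map_zero, smul_zero]
  | tmul z t =>
    rw [faltingsLevel_tmul_apply, map_smul, ← LinearMap.comp_apply, galoisH1Bar_comp_h1PullBarQ, LinearMap.comp_apply, hc _ y.2,
      map_smul, smul_comm]
  | add x x' hx hx' => rw [map_add, LinearMap.add_apply, map_add, hx, hx', smul_add]

/-- `c ⊗ t ↦ ι⁻¹(c) ⊗ t : ℚ_ℓ^{ac} ⊗_ℚ (ℚ ⊗ Hom_E(X, A_μ)) → ℂ ⊗_{M_μ} (ℚ ⊗ Hom_E(X, A_μ))` — «`⊗_{M_μ,ι_ℓ} ℚ_ℓ^{ac}`» read as the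
quotient of `⊗_ℚ ℚ_ℓ^{ac}` (additive, surjective). [cite: Liu2021, Thm 4.18 proof (FJcycle.tex l. 2258)] -/
def toComplexTensor : AlgebraicClosure ℚ_[ℓ] ⊗[ℚ] QHom X (AμOne φ ιE hμ hw Car obj) →+
    ℂ ⊗[fieldOfValues E μ] QHom X (AμOne φ ιE hμ hw Car obj) :=
  TensorProduct.liftAddHom
    { toFun := fun c => (TensorProduct.mk (fieldOfValues E μ) ℂ (QHom X (AμOne φ ιE hμ hw Car obj)) (ι.symm c)).toAddMonoidHom
      map_zero' := by rw [map_zero, map_zero]; rfl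
      map_add' := fun c c' => by rw [map_add, map_add]; rfl }
    (fun q c t => by
      change ι.symm (q • c) ⊗ₜ[fieldOfValues E μ] t = ι.symm c ⊗ₜ[fieldOfValues E μ] (q • t)
      have hq : (q • t) = (algebraMap ℚ (fieldOfValues E μ) q) • t := by
        rw [smul_eq_postAlg, RingHom.map_rat_algebraMap, RingHom.map_rat_algebraMap, AlgHom.commutes, Module.algebraMap_end_apply]
      have hq' : ι.symm (q • c) = (algebraMap ℚ (fieldOfValues E μ) q) • ι.symm c := by
        rw [Rat.smul_def, map_mul, map_ratCast, Algebra.smul_def, ← IsScalarTower.algebraMap_apply, eq_ratCast]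
      rw [hq, hq', TensorProduct.smul_tmul])

/-- on pure tensors. [cite: Liu2021, Thm 4.18 proof (FJcycle.tex l. 2258)] -/
theorem toComplexTensor_tmul (c : AlgebraicClosure ℚ_[ℓ]) (t : QHom X (AμOne φ ιE hμ hw Car obj)) :
    toComplexTensor φ ιE hμ hw Car obj ℓ ι X (c ⊗ₜ t) = ι.symm c ⊗ₜ t := by
  rw [toComplexTensor, TensorProduct.liftAddHom_tmul]
  rfl

/-- `toComplexTensor` is surjective. [cite: Liu2021, Thm 4.18 proof (FJcycle.tex l. 2258)] -/
theorem toComplexTensor_surjective : Function.Surjective (toComplexTensor φ ιE hμ hw Car obj ℓ ι X) := by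
  intro w
  induction w using TensorProduct.induction_on with
  | zero => exact ⟨0, map_zero _⟩
  | tmul z t => exact ⟨ι z ⊗ₜ t, by rw [toComplexTensor_tmul, RingEquiv.symm_apply_apply]⟩
  | add x y hx hy =>
    obtain ⟨a, rfl⟩ := hx
    obtain ⟨b, rfl⟩ := hy
    exact ⟨a + b, map_add _ _ _⟩

/-- `toComplexTensor` is `ι⁻¹`-semilinear. [cite: Liu2021, Thm 4.18 proof (FJcycle.tex l. 2258)] -/
theorem toComplexTensor_smul (c : AlgebraicClosure ℚ_[ℓ]) (w : AlgebraicClosure ℚ_[ℓ] ⊗[ℚ] QHom X (AμOne φ ιE hμ hw Car obj)) :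
    toComplexTensor φ ιE hμ hw Car obj ℓ ι X (c • w) = ι.symm c • toComplexTensor φ ιE hμ hw Car obj ℓ ι X w := by
  induction w using TensorProduct.induction_on with
  | zero => rw [smul_zero, map_zero, smul_zero]
  | tmul c' t => rw [TensorProduct.smul_tmul', toComplexTensor_tmul, toComplexTensor_tmul, smul_eq_mul, map_mul, TensorProduct.smul_tmul',
      smul_eq_mul]
  | add x y hx hy => rw [smul_add, map_add, map_add, hx, hy, smul_add]

/-- Compatibility of `Φ` with the uncut Tate map on `H¹`: `Φ(π u)(y) = (c ⊗ t ↦ c · t^*)(u)(y)` for `y` on the line.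
[cite: Liu2021, Thm 4.18 proof (FJcycle.tex l. 2258)] -/
theorem faltingsLevel_toComplexTensor_apply (u : AlgebraicClosure ℚ_[ℓ] ⊗[ℚ] QHom X (AμOne φ ιE hμ hw Car obj))
    (y : cmEigenline ℓ (AμOne φ ιE hμ hw Car obj) (IdeleClassGroup.muAlgValueField E μ) (iOne φ ιE hμ hw Car obj) ι) :
    faltingsLevel φ ιE hμ hw Car obj ℓ ι X (toComplexTensor φ ιE hμ hw Car obj ℓ ι X u) y = h1PullBarK ℓ X (AμOne φ ιE hμ hw Car obj) u y := by
  induction u using TensorProduct.induction_on with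
  | zero => rw [map_zero, map_zero, map_zero, LinearMap.zero_apply, LinearMap.zero_apply]
  | tmul c t => rw [toComplexTensor_tmul, faltingsLevel_tmul_apply, RingEquiv.apply_symm_apply, h1PullBarK_tmul, LinearMap.smul_apply]
  | add x x' hx hx' => rw [map_add, map_add, map_add, LinearMap.add_apply, LinearMap.add_apply, hx, hx']

/-- The `M_μ`-action `1 ⊗ (i_μ m)_*` on `ℚ_ℓ^{ac} ⊗_ℚ (ℚ ⊗ Hom)` goes, under `π = toComplexTensor`, to multiplication by `m ∈ ℂ`.
[cite: Liu2021, Def. 4.16 (FJcycle.tex l. 2219)] -/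
theorem toComplexTensor_baseChange_postAlg (m : IdeleClassGroup.muAlgValueField E μ)
    (u : AlgebraicClosure ℚ_[ℓ] ⊗[ℚ] QHom X (AμOne φ ιE hμ hw Car obj)) :
    toComplexTensor φ ιE hμ hw Car obj ℓ ι X ((RestOne.postAlg X _ (iOne φ ιE hμ hw Car obj m)).baseChange (AlgebraicClosure ℚ_[ℓ]) u) =
      (m : ℂ) • toComplexTensor φ ιE hμ hw Car obj ℓ ι X u := by
  induction u using TensorProduct.induction_on with
  | zero => rw [map_zero, map_zero, smul_zero]
  | tmul c t =>
    have h : RestOne.postAlg X _ (iOne φ ιE hμ hw Car obj m) t = (toFieldOfValues m) • t := by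
      rw [smul_eq_postAlg, ofFieldOfValues_toFieldOfValues]
    rw [LinearMap.baseChange_tmul, toComplexTensor_tmul, toComplexTensor_tmul, h, ← TensorProduct.smul_tmul, TensorProduct.smul_tmul',
      Algebra.smul_def]
    rfl
  | add x y hx hy => rw [map_add, map_add, map_add, hx, hy, smul_add]

/-- The same action goes, under the uncut Tate map `c ⊗ t ↦ c · t^*`, to precomposition with `1 ⊗ ᵗV_ℓ(i_μ m)`.
[cite: Liu2021, Def. 4.16 (FJcycle.tex l. 2219)] -/
theorem h1PullBarK_baseChange_postAlg (m : IdeleClassGroup.muAlgValueField E μ)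
    (u : AlgebraicClosure ℚ_[ℓ] ⊗[ℚ] QHom X (AμOne φ ιE hμ hw Car obj)) :
    h1PullBarK ℓ X _ ((RestOne.postAlg X _ (iOne φ ιE hμ hw Car obj m)).baseChange (AlgebraicClosure ℚ_[ℓ]) u) =
      h1PullBarK ℓ X _ u ∘ₗ ((rationalTateAction _ ℓ (iOne φ ιE hμ hw Car obj m)).dualMap).baseChange (AlgebraicClosure ℚ_[ℓ]) := by
  induction u using TensorProduct.induction_on with
  | zero => rw [map_zero, map_zero, LinearMap.zero_comp]
  | tmul c t => rw [LinearMap.baseChange_tmul, h1PullBarK_tmul, h1PullBarK_tmul, h1PullBarQ_postAlg, LinearMap.smul_comp]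
  | add x y hx hy => rw [map_add, map_add, map_add, hx, hy, LinearMap.add_comp]

/-- **INJECTIVITY of the level map `Φ`** ([Liu2021] l. 2258: the map is an isomorphism; injectivity half, UNCONDITIONAL — Mumford
§19 Thm 3 ⊗ `ℚ_ℓ^{ac}` cut by the `τ`-idempotent of `ℚ_ℓ^{ac} ⊗ M_μ`): if `Φ(w) = 0` then `w = 0` in
`ℂ ⊗_{M_μ} (ℚ ⊗ Hom_E(X, A_μ))`.  Proof: lift `w = π(u)`; `u^*` kills the line, hence `(P u)^* = u^* ∘ P = 0` for the projector
`P = Σ c_j (i m_j)_*` of `CMEigenlineRankOne.exists_cmEigenline_projector`; so `P u = 0` (`h1PullBarK_injective`), and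
`π(P u) = (Σ c_j ι(m_j)) · π(u) = π(u)`. [cite: Liu2021, Thm 4.18 proof (FJcycle.tex l. 2254–2262)] [cite: MumfordAV1970, §19 Thm. 3] -/
theorem faltingsLevel_injective : Function.Injective (faltingsLevel φ ιE hμ hw Car obj ℓ ι X) := by
  haveI : FiniteDimensional ℚ (IdeleClassGroup.muAlgValueField E μ) := hμ.finiteDimensional_muAlgValueField
  haveI : NumberField (IdeleClassGroup.muAlgValueField E μ) := NumberField.mk
  refine (injective_iff_map_eq_zero _).mpr fun w hw0 => ?_
  obtain ⟨u, rfl⟩ := toComplexTensor_surjective φ ιE hμ hw Car obj ℓ ι X w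
  obtain ⟨S, hS1, hSmem, hSid, -⟩ := exists_cmEigenline_projector ℓ (AμOne φ ιE hμ hw Car obj)
    (IdeleClassGroup.muAlgValueField E μ) (iOne φ ιE hμ hw Car obj) ι
  -- `u^*` kills the line
  have hker : ∀ y ∈ cmEigenline ℓ (AμOne φ ιE hμ hw Car obj) (IdeleClassGroup.muAlgValueField E μ) (iOne φ ιE hμ hw Car obj) ι,
      h1PullBarK ℓ X _ u y = 0 := fun y hy => by
    rw [← faltingsLevel_toComplexTensor_apply φ ιE hμ hw Car obj ℓ ι X u ⟨y, hy⟩, hw0, LinearMap.zero_apply]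
  -- the averaged lift `u' = Σ c_j (1 ⊗ (i m_j)_*) u` has `u'^* = u^* ∘ P = 0`
  set u' := ∑ p ∈ S, p.1 • (RestOne.postAlg X _ (iOne φ ιE hμ hw Car obj p.2)).baseChange (AlgebraicClosure ℚ_[ℓ]) u with hu'
  have hu'0 : h1PullBarK ℓ X _ u' = 0 := by
    refine LinearMap.ext fun x => ?_
    rw [hu', map_sum, LinearMap.sum_apply, LinearMap.zero_apply]
    calc ∑ p ∈ S, h1PullBarK ℓ X _ (p.1 • (RestOne.postAlg X _ (iOne φ ιE hμ hw Car obj p.2)).baseChange (AlgebraicClosure ℚ_[ℓ]) u) x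
        = ∑ p ∈ S, h1PullBarK ℓ X _ u
            (p.1 • ((rationalTateAction _ ℓ (iOne φ ιE hμ hw Car obj p.2)).dualMap).baseChange (AlgebraicClosure ℚ_[ℓ]) x) :=
          Finset.sum_congr rfl fun p _ => by
            rw [map_smul, LinearMap.smul_apply, h1PullBarK_baseChange_postAlg, LinearMap.comp_apply, ← LinearMap.map_smul]
      _ = h1PullBarK ℓ X _ u
            (∑ p ∈ S, p.1 • ((rationalTateAction _ ℓ (iOne φ ιE hμ hw Car obj p.2)).dualMap).baseChange (AlgebraicClosure ℚ_[ℓ]) x) := by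
          rw [map_sum]
      _ = 0 := hker _ (hSmem x)
  have hu'z : u' = 0 := h1PullBarK_injective ℓ X _ (Literature.AlgebraicGeometry.Motives.natCast_ne_zero_of_numberField ℓ)
    (hu'0.trans (map_zero _).symm)
  -- and `π(u') = π(u)`
  have hπ : toComplexTensor φ ιE hμ hw Car obj ℓ ι X u' = toComplexTensor φ ιE hμ hw Car obj ℓ ι X u := by
    rw [hu', map_sum]
    simp_rw [toComplexTensor_smul, toComplexTensor_baseChange_postAlg, smul_smul]
    rw [← Finset.sum_smul]
    have : (∑ p ∈ S, ι.symm p.1 * (p.2 : ℂ)) = 1 := by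
      apply ι.injective
      rw [map_sum, map_one, ← hS1]
      exact Finset.sum_congr rfl fun p _ => by rw [map_mul, RingEquiv.apply_symm_apply]
    rw [this, one_smul]
  rw [← hπ, hu'z, map_zero]

/-- **SURJECTIVITY of the level map `Φ` onto the `Γ_E`-compatible maps** ([Liu2021] l. 2258–2262: «By Faltings' isogeny theorem
[Fal83], we have a canonical isomorphism `Ω(μ) ⊗_{M_μ,ι_ℓ} ℚ_ℓ^{ac} ≃ Hom_{ℚ_ℓ^{ac}[Gal]}(ℚ_ℓ^{ac}·α, H¹_ét(…))`», at ONE level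
`X`), GRANTED the named fact `faltings_tate_bijective X A_μ ℓ` (VI-1, hypothesis `hF`): every `h : ℚ_ℓ^{ac}·α → ℚ_ℓ^{ac} ⊗ H¹_ét(X)`
on which each `σ ∈ Γ_E` acts as it does on the line is `Φ(w)` for some `w`.  Proof: extend `h` to `H = h ∘ P` (`P` the `M_μ`-polynomial
projector onto the line, `exists_cmEigenline_projector`; `H` is `Γ_E`-equivariant because `P` commutes with `Γ_E` and `Γ_E` acts on
the line by scalars, `exists_galoisH1Bar_eq_smul`), write `H` as a combination of pull-backs (`mem_span_h1PullBar_of_galois`), and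
restrict back to the line. [cite: Liu2021, Thm 4.18 proof (FJcycle.tex l. 2258–2262)] [cite: Faltings1983Endlichkeit, §5 Satz 4 and Korollar 1] -/
theorem exists_faltingsLevel_eq (hF : faltings_tate_bijective X (AμOne φ ιE hμ hw Car obj) ℓ)
    (h : cmEigenline ℓ (AμOne φ ιE hμ hw Car obj) (IdeleClassGroup.muAlgValueField E μ) (iOne φ ιE hμ hw Car obj) ι →ₗ[AlgebraicClosure ℚ_[ℓ]]
      AlgebraicClosure ℚ_[ℓ] ⊗[ℚ_[ℓ]] Module.Dual ℚ_[ℓ] (X.rationalTateModule ℓ))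
    (hh : ∀ (σ : Field.absoluteGaloisGroup E) (c : AlgebraicClosure ℚ_[ℓ]),
      (∀ x ∈ cmEigenline ℓ (AμOne φ ιE hμ hw Car obj) (IdeleClassGroup.muAlgValueField E μ) (iOne φ ιE hμ hw Car obj) ι,
        galoisH1Bar ℓ (AμOne φ ιE hμ hw Car obj) σ x = c • x) →
      ∀ y, galoisH1Bar ℓ X σ (h y) = c • h y) :
    ∃ w, faltingsLevel φ ιE hμ hw Car obj ℓ ι X w = h := by
  haveI : FiniteDimensional ℚ (IdeleClassGroup.muAlgValueField E μ) := hμ.finiteDimensional_muAlgValueField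
  haveI : NumberField (IdeleClassGroup.muAlgValueField E μ) := NumberField.mk
  have hℓ : (ℓ : E) ≠ 0 := Literature.AlgebraicGeometry.Motives.natCast_ne_zero_of_numberField ℓ
  have hdim := RestOne.hdimOne φ ιE hμ hw Car obj
  obtain ⟨S, -, hSmem, hSid, hScomm⟩ := exists_cmEigenline_projector ℓ (AμOne φ ιE hμ hw Car obj)
    (IdeleClassGroup.muAlgValueField E μ) (iOne φ ιE hμ hw Car obj) ι
  -- the projector onto the line, as a linear map into the line
  let P : Module.End (AlgebraicClosure ℚ_[ℓ])
      (AlgebraicClosure ℚ_[ℓ] ⊗[ℚ_[ℓ]] Module.Dual ℚ_[ℓ] ((AμOne φ ιE hμ hw Car obj).rationalTateModule ℓ)) :=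
    ∑ p ∈ S, p.1 • ((rationalTateAction _ ℓ (iOne φ ιE hμ hw Car obj p.2)).dualMap).baseChange (AlgebraicClosure ℚ_[ℓ])
  have hP : ∀ x, P x = ∑ p ∈ S, p.1 • ((rationalTateAction _ ℓ (iOne φ ιE hμ hw Car obj p.2)).dualMap).baseChange
      (AlgebraicClosure ℚ_[ℓ]) x := fun x => by
    simp only [P, LinearMap.sum_apply, LinearMap.smul_apply]
  let P' := LinearMap.codRestrict (cmEigenline ℓ (AμOne φ ιE hμ hw Car obj) (IdeleClassGroup.muAlgValueField E μ)
    (iOne φ ιE hμ hw Car obj) ι) P (fun x => by rw [hP]; exact hSmem x)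
  -- `H = h ∘ P` is `Γ_E`-equivariant
  have hH : ∀ σ : Field.absoluteGaloisGroup E, (h ∘ₗ P') ∘ₗ galoisH1Bar ℓ (AμOne φ ιE hμ hw Car obj) σ = galoisH1Bar ℓ X σ ∘ₗ (h ∘ₗ P') := by
    intro σ
    obtain ⟨c, hc⟩ := exists_galoisH1Bar_eq_smul ℓ (AμOne φ ιE hμ hw Car obj) (IdeleClassGroup.muAlgValueField E μ)
      (iOne φ ιE hμ hw Car obj) ι hℓ hdim σ
    refine LinearMap.ext fun x => ?_
    have h1 : P' (galoisH1Bar ℓ (AμOne φ ιE hμ hw Car obj) σ x) = c • P' x := by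
      apply Subtype.ext
      change P (galoisH1Bar ℓ (AμOne φ ιE hμ hw Car obj) σ x) = c • P x
      rw [hP, hP, hScomm _ (galoisH1Bar_comp_dualMap_baseChange ℓ _ (iOne φ ιE hμ hw Car obj) σ) x, ← hP, hc _ (by rw [hP]; exact hSmem x)]
    rw [LinearMap.comp_apply, LinearMap.comp_apply, h1, map_smul, LinearMap.comp_apply, LinearMap.comp_apply, hh σ c hc]
  -- Faltings: `H` is a combination of pull-backs; every such combination, restricted to the line, is a `Φ(w)`
  have key : ∀ G ∈ Submodule.span (AlgebraicClosure ℚ_[ℓ]) (Set.range (h1PullBar ℓ : (X ⟶ AμOne φ ιE hμ hw Car obj) → _)),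
      ∃ w, ∀ y, faltingsLevel φ ιE hμ hw Car obj ℓ ι X w y = G y := by
    intro G hG
    induction hG using Submodule.span_induction with
    | mem G hG =>
      obtain ⟨f, rfl⟩ := hG
      exact ⟨(1 : ℂ) ⊗ₜ ((1 : ℚ) ⊗ₜ f), fun y => by
        rw [faltingsLevel_tmul_apply, map_one, one_smul, h1PullBarQ_tmul, Rat.cast_one, one_smul]⟩
    | zero => exact ⟨0, fun y => by rw [map_zero]; rfl⟩
    | add G G' _ _ hG hG' =>
      obtain ⟨w, hw'⟩ := hG
      obtain ⟨w', hw''⟩ := hG'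
      exact ⟨w + w', fun y => by rw [map_add, LinearMap.add_apply, hw', hw'', LinearMap.add_apply]⟩
    | smul c G _ hG =>
      obtain ⟨w, hw'⟩ := hG
      exact ⟨ι.symm c • w, fun y => by rw [faltingsLevel_smul, RingEquiv.apply_symm_apply, LinearMap.smul_apply, hw', LinearMap.smul_apply]⟩
  obtain ⟨w, hw'⟩ := key _ (mem_span_h1PullBar_of_galois ℓ X _ hF _ hH)
  refine ⟨w, LinearMap.ext fun y => ?_⟩
  rw [hw', LinearMap.comp_apply]
  congr 1
  apply Subtype.ext
  change P y = y
  rw [hP]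
  exact hSid _ y.2

/-- Pull-back of sources: `Φ_{X'}(z ⊗ u^* t)(y) = u^* (Φ_X(z ⊗ t)(y))` for `u : X' → X`. [cite: Liu2021, Thm 4.18 proof (FJcycle.tex l. 2254–2262)] -/
theorem faltingsLevel_tmul_pre_apply {X X' : AbelianVariety E} (u : X' ⟶ X) (z : ℂ) (t : QHom X (AμOne φ ιE hμ hw Car obj))
    (y : cmEigenline ℓ (AμOne φ ιE hμ hw Car obj) (IdeleClassGroup.muAlgValueField E μ) (iOne φ ιE hμ hw Car obj) ι) :
    faltingsLevel φ ιE hμ hw Car obj ℓ ι X' (z ⊗ₜ RestOne.pre (AμOne φ ιE hμ hw Car obj) u t) y =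
      h1PullBar ℓ u (faltingsLevel φ ιE hμ hw Car obj ℓ ι X (z ⊗ₜ t) y) := by
  rw [faltingsLevel_tmul_apply, faltingsLevel_tmul_apply, h1PullBarQ_pre, LinearMap.comp_apply, map_smul]

end Level

end Literature.NumberTheory.Automorphic.Liu2021.AppendixC

end
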